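import Summits.QuantumAdvantage.AdviceFreeQNC0.WalkTransport
import Summits.QuantumAdvantage.AdviceFreeQNC0.HardcoreCylinder
import Summits.QuantumAdvantage.AdviceFreeQNC0.AffBells22FrameJunta
import Summits.QuantumAdvantage.AdviceFreeQNC0.RingLocalPolylog
import HarnessLib

/-!
# RingHorizon (decomp-qadv lens-2 g10; tree package of node «HorizonDial»): the BOX-PARITY / HORIZON LAW

§1 box-parity law in walk coordinates (degree-free, every charge) · §2 ring frame (chart onto; horizon law) ·
§3 windows of radius `r`, `2r+7 ≤ N`; fan-in `f`, `4f+11 ≤ N` (arbitrary wiring).  Supports items 27380 / 27432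
(`ExactnessDial.NoPerfectConst3` / `NoPerfectTwo3`): every perfect candidate must have a PANOPTIC output.

BOX-PARITY LAW: if every cut `g` of a walk strategy `y` is BLIND to some aligned pair-block `{2j, 2j+1}` of walk bits that it
does not straddle (`g ≠ 2j+1`), then `y` loses the walk game on some input.  Proof: sum the number of
"live selected cuts" over the box `{0,1,2}^k` of block weights; per cut the sum is even (the character runs over
`ℤ/3` as the blind block's weight runs over `0,1,2`), per input it is odd if `y` wins everywhere, and the box has
odd size `3^k`.
-/

namespace Summit.QuantumAdvantage.AdviceFreeQNC0

open Finset

namespace RingHorizon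

variable {n : ℕ}

/-- The box input with block weights `t : Fin k → ZMod 3`: `u_{2j} = [t j ≠ 0]`, `u_{2j+1} = [t j = 2]`, other bits `0`. -/
def boxU (k : ℕ) (t : Fin k → ZMod 3) : Fin n → Bool := fun i =>
  if h : i.val / 2 < k then
    (if i.val % 2 = 0 then decide (t ⟨i.val / 2, h⟩ ≠ 0) else decide (t ⟨i.val / 2, h⟩ = 2))
  else false
/-- Shifting the weight of block `j` by `s`. -/
def shift {k : ℕ} (j : Fin k) (s : ZMod 3) (t : Fin k → ZMod 3) : Fin k → ZMod 3 :=
  fun i => if i = j then t i + s else t i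
/-- Ring-game helper `shift_add` (lens-2 law package; see the module docstring). -/
theorem shift_add {k : ℕ} (j : Fin k) (s s' : ZMod 3) (t : Fin k → ZMod 3) :
    shift j s' (shift j s t) = shift j (s + s') t := by
  funext i; unfold shift; split_ifs <;> ring
/-- `shift j s` is a bijection of the box. -/
def shiftEquiv {k : ℕ} (j : Fin k) (s : ZMod 3) : (Fin k → ZMod 3) ≃ (Fin k → ZMod 3) where
  toFun := shift j s
  invFun := shift j (-s)
  left_inv t := by funext i; simp only [shift]; split_ifs <;> ring
  right_inv t := by funext i; simp only [shift]; split_ifs <;> ring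
/-- Box inputs that differ only in block `j` agree off the coordinates `2j, 2j+1`. -/
theorem boxU_shift_of_ne {k : ℕ} (j : Fin k) (s : ZMod 3) (t : Fin k → ZMod 3) (i : Fin n)
    (h1 : i.val ≠ 2 * j.val) (h2 : i.val ≠ 2 * j.val + 1) :
    boxU k (shift j s t) i = boxU k t i := by
  unfold boxU shift
  by_cases hi : i.val / 2 < k
  · rw [dif_pos hi, dif_pos hi]
    have hne : (⟨i.val / 2, hi⟩ : Fin k) ≠ j := by
      intro he
      have : i.val / 2 = j.val := by rw [← he]
      omega
    simp only [if_neg hne]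
  · rw [dif_neg hi, dif_neg hi]

/-- The two coordinates of block `j`. -/
theorem boxU_even {k : ℕ} (j : Fin k) (t : Fin k → ZMod 3) (i : Fin n) (hi : i.val = 2 * j.val) :
    boxU k t i = decide (t j ≠ 0) := by
  unfold boxU
  have h : i.val / 2 < k := by rw [hi]; omega
  rw [dif_pos h, if_pos (by omega)]
  have : (⟨i.val / 2, h⟩ : Fin k) = j := Fin.ext (by simp [hi])
  rw [this]

/-- Ring-game helper `boxU_odd` (lens-2 law package; see the module docstring). -/
theorem boxU_odd {k : ℕ} (j : Fin k) (t : Fin k → ZMod 3) (i : Fin n) (hi : i.val = 2 * j.val + 1) :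
    boxU k t i = decide (t j = 2) := by
  unfold boxU
  have h : i.val / 2 < k := by rw [hi]; omega
  rw [dif_pos h, if_neg (by omega)]
  have : (⟨i.val / 2, h⟩ : Fin k) = j := Fin.ext (by simp [hi]; omega)
  rw [this]

/-- If `u, u'` agree off `{a, b}`, the filtered counts differ exactly by the contributions of `a` and `b`. -/
theorem card_filter_two (p : Fin n → Prop) [DecidablePred p] (u u' : Fin n → Bool) (a b : Fin n) (hab : a ≠ b)
    (h : ∀ i, i ≠ a → i ≠ b → u i = u' i) :
    (univ.filter fun i => p i ∧ u i = true).card + (if p a ∧ u' a = true then 1 else 0) + (if p b ∧ u' b = true then 1 else 0)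
      = (univ.filter fun i => p i ∧ u' i = true).card + (if p a ∧ u a = true then 1 else 0) + (if p b ∧ u b = true then 1 else 0) := by
  rw [card_filter, card_filter]
  rw [← Finset.add_sum_erase _ _ (mem_univ a), ← Finset.add_sum_erase _ _ (mem_univ a)]
  have hb : b ∈ univ.erase a := by rw [mem_erase]; exact ⟨hab.symm, mem_univ b⟩
  rw [← Finset.add_sum_erase _ _ hb, ← Finset.add_sum_erase _ _ hb]
  have hrest : ∑ x ∈ (univ.erase a).erase b, (if p x ∧ u x = true then 1 else 0)
      = ∑ x ∈ (univ.erase a).erase b, (if p x ∧ u' x = true then 1 else 0) := by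
    apply Finset.sum_congr rfl
    intro x hx
    rw [mem_erase, mem_erase] at hx
    rw [h x hx.2.1 hx.1]
  rw [hrest]
  omega

/-- weight bookkeeping: the total weight of a box input changes by `+1 (mod 3)` when block `j` is shifted by `1`. -/
theorem wt_shift_mod {k : ℕ} (hk : 2 * k ≤ n) (j : Fin k) (t : Fin k → ZMod 3) :
    wt (boxU (n := n) k (shift j 1 t)) % 3 = (wt (boxU (n := n) k t) + 1) % 3 := by
  have ha : 2 * j.val < n := by omega
  have hb : 2 * j.val + 1 < n := by omega
  set a : Fin n := ⟨2 * j.val, ha⟩ with ha_def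
  set b : Fin n := ⟨2 * j.val + 1, hb⟩ with hb_def
  have key := card_filter_two (fun _ => True) (boxU k (shift j 1 t)) (boxU k t) a b
    (by intro h; have := congrArg Fin.val h; simp [a, b] at this)
    (by intro i h1 h2; apply boxU_shift_of_ne
        · intro h; exact h1 (Fin.ext h)
        · intro h; exact h2 (Fin.ext h))
  have e1 : (univ.filter fun i => True ∧ boxU (n := n) k (shift j 1 t) i = true) = (univ.filter fun i => boxU (n := n) k (shift j 1 t) i = true) := by
    apply filter_congr; intro i _; simp
  have e2 : (univ.filter fun i => True ∧ boxU (n := n) k t i = true) = (univ.filter fun i => boxU (n := n) k t i = true) := by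
    apply filter_congr; intro i _; simp
  rw [e1, e2] at key
  unfold wt
  rw [boxU_even j _ a rfl, boxU_odd j _ b rfl, boxU_even j _ a rfl, boxU_odd j _ b rfl] at key
  simp only [true_and, shift, if_pos] at key
  -- case analysis on t j
  have h3 : ∀ s : ZMod 3, s = 0 ∨ s = 1 ∨ s = 2 := by decide
  rcases h3 (t j) with h | h | h <;> simp (decide := true) [h] at key <;> omega

/-- prefix-weight bookkeeping: `+1 (mod 3)` if the block lies before the cut, unchanged if after. -/
theorem wtPrefix_shift_mod {k : ℕ} (hk : 2 * k ≤ n) (j : Fin k) (t : Fin k → ZMod 3) (g : ℕ) :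
    wtPrefix (boxU (n := n) k (shift j 1 t)) g % 3 =
      (wtPrefix (boxU (n := n) k t) g + (if 2 * j.val + 2 ≤ g then 1 else 0)) % 3 ∨ g = 2 * j.val + 1 := by
  by_cases hg : g = 2 * j.val + 1
  · exact Or.inr hg
  left
  have ha : 2 * j.val < n := by omega
  have hb : 2 * j.val + 1 < n := by omega
  set a : Fin n := ⟨2 * j.val, ha⟩ with ha_def
  set b : Fin n := ⟨2 * j.val + 1, hb⟩ with hb_def
  have key := card_filter_two (fun i : Fin n => i.val < g) (boxU k (shift j 1 t)) (boxU k t) a b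
    (by intro h; have := congrArg Fin.val h; simp [a, b] at this)
    (by intro i h1 h2; apply boxU_shift_of_ne
        · intro h; exact h1 (Fin.ext h)
        · intro h; exact h2 (Fin.ext h))
  unfold wtPrefix
  rw [boxU_even j _ a rfl, boxU_odd j _ b rfl, boxU_even j _ a rfl, boxU_odd j _ b rfl] at key
  simp only [shift, if_pos] at key
  have h3 : ∀ s : ZMod 3, s = 0 ∨ s = 1 ∨ s = 2 := by decide
  by_cases hbefore : 2 * j.val + 2 ≤ g
  · have h1 : a.val < g := by simp [a]; omega
    have h2 : b.val < g := by simp [b]; omega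
    rw [if_pos hbefore]
    rcases h3 (t j) with h | h | h <;> simp (decide := true) [h, h1, h2] at key <;> omega
  · have h1 : ¬ a.val < g := by simp [a]; omega
    have h2 : ¬ b.val < g := by simp [b]; omega
    rw [if_neg hbefore]
    rcases h3 (t j) with h | h | h <;> simp (decide := true) [h, h1, h2] at key <;> omega

/-- **THE BOX-PARITY LAW (walk coordinates; every charge, no degree hypothesis).**  If every cut `g` is blind to
some aligned pair-block `{2j, 2j+1}` (`j < k`, `2k ≤ n`) which it does not straddle (`g ≠ 2j+1`), the walk strategy
`y` loses on some input. -/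
theorem ringWinU_box_fail (c : ℕ) {k : ℕ} (hk : 2 * k ≤ n) (y : Fin (n + 1) → (Fin n → Bool) → Bool)
    (hy : ∀ g : Fin (n + 1), ∃ j : Fin k, g.val ≠ 2 * j.val + 1 ∧
      ∀ u u' : Fin n → Bool, (∀ i : Fin n, i.val ≠ 2 * j.val → i.val ≠ 2 * j.val + 1 → u i = u' i) →
        y g u = y g u') :
    ∃ u, ringWinU c y u = false := by
  by_contra hall
  have hwin : ∀ u, ringWinU c y u = true := fun u => by
    cases h : ringWinU c y u
    · exact absurd ⟨u, h⟩ hall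
    · rfl
  let ind : Fin (n + 1) → (Fin k → ZMod 3) → ℕ := fun g t =>
    if (y g (boxU k t) = true ∧ (c + g.val + walkExp (boxU (n := n) k t) g.val) % 3 ≠ 0) then 1 else 0
  -- per input: the number of live selected cuts is odd
  have hodd : ∀ t : Fin k → ZMod 3, (∑ g, ind g t) % 2 = 1 := by
    intro t
    have h := hwin (boxU k t)
    unfold ringWinU at h
    rw [decide_eq_true_eq, card_filter] at h
    exact h
  -- per cut: the sum over the box is even
  have heven : ∀ g : Fin (n + 1), (∑ t : Fin k → ZMod 3, ind g t) % 2 = 0 := by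
    intro g
    obtain ⟨j, hgj, hblind⟩ := hy g
    have hs1 : ∑ t, ind g (shift j 1 t) = ∑ t, ind g t := Equiv.sum_comp (shiftEquiv j 1) (ind g)
    have hs2 : ∑ t, ind g (shift j 2 t) = ∑ t, ind g t := Equiv.sum_comp (shiftEquiv j 2) (ind g)
    have h3 : 3 * ∑ t, ind g t = ∑ t, (ind g t + ind g (shift j 1 t) + ind g (shift j 2 t)) := by
      rw [sum_add_distrib, sum_add_distrib, hs1, hs2]; ring
    have hterm : ∀ t : Fin k → ZMod 3, ind g t + ind g (shift j 1 t) + ind g (shift j 2 t) =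
        2 * (if y g (boxU (n := n) k t) = true then 1 else 0) := by
      intro t
      have hy1 : y g (boxU k (shift j 1 t)) = y g (boxU k t) :=
        hblind _ _ (fun i h1 h2 => boxU_shift_of_ne j 1 t i h1 h2)
      have hy2 : y g (boxU k (shift j 2 t)) = y g (boxU k t) :=
        hblind _ _ (fun i h1 h2 => boxU_shift_of_ne j 2 t i h1 h2)
      have hw1 := wt_shift_mod (n := n) hk j t
      have hw2 := wt_shift_mod (n := n) hk j (shift j 1 t)
      rw [shift_add] at hw2
      have hp1 := (wtPrefix_shift_mod (n := n) hk j t g.val).resolve_right hgj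
      have hp2 := (wtPrefix_shift_mod (n := n) hk j (shift j 1 t) g.val).resolve_right hgj
      rw [shift_add] at hp2
      have e12 : ((1 : ZMod 3) + 1) = 2 := by decide
      rw [e12] at hw2 hp2
      simp only [ind, hy1, hy2]
      unfold walkExp
      by_cases hb : 2 * j.val + 2 ≤ g.val
      · rw [if_pos hb] at hp1 hp2
        by_cases hyg : y g (boxU k t) = true
        · simp only [hyg, true_and, if_true]
          split_ifs <;> omega
        · simp [hyg]
      · rw [if_neg hb] at hp1 hp2
        by_cases hyg : y g (boxU k t) = true
        · simp only [hyg, true_and, if_true]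
          split_ifs <;> omega
        · simp [hyg]
    rw [Finset.sum_congr rfl (fun t _ => hterm t), ← mul_sum] at h3
    omega
  -- total parity, two ways
  have hS1 : (∑ t : Fin k → ZMod 3, ∑ g, ind g t) % 2 = 1 := by
    rw [sum_nat_mod, Finset.sum_congr rfl (fun t _ => hodd t)]
    simp only [sum_const, card_univ, smul_eq_mul, mul_one]
    rw [Fintype.card_fun, ZMod.card, Fintype.card_fin, Nat.pow_mod]
    norm_num
  have hS2 : (∑ t : Fin k → ZMod 3, ∑ g, ind g t) % 2 = 0 := by
    rw [sum_comm, sum_nat_mod, Finset.sum_congr rfl (fun g _ => heven g)]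
    simp
  omega

/-! ## §2 The ring frame: chart surjectivity and the HORIZON LAW (degree-free) -/

section RingFrame

open Literature.Computability.QuantumComplexity Literature.Computability.QuantumComplexity.RingHLF


/-- **The chart is onto the odd class** (`xOfU_uVec` injective; both sides have `2ⁿ` elements, `Fib19.card_isOdd`). -/
theorem exists_odd_uVec_eq (hn : 2 ≤ n) (u : Fin n → Bool) :
    ∃ x : Fin (n + 1) → Bool, OddZeros x ∧ uVec x = u := by
  obtain ⟨x, hx, hxu⟩ := Finset.surj_on_of_inj_on_of_card_le
    (s := univ.filter fun x : Fin (n + 1) → Bool => Fib19.IsOdd x) (t := (univ : Finset (Fin n → Bool)))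
    (fun x _ => uVec x) (fun _ _ => mem_univ _)
    (fun x₁ x₂ h₁ h₂ heq => by
      rw [mem_filter] at h₁ h₂
      rw [← xOfU_uVec hn x₁ ((Fib19.isOdd_iff_oddZeros x₁).1 h₁.2),
        ← xOfU_uVec hn x₂ ((Fib19.isOdd_iff_oddZeros x₂).1 h₂.2), heq])
    (by rw [card_univ, Fintype.card_fun, Fintype.card_bool, Fintype.card_fin, Fib19.card_isOdd (by omega),
          Nat.add_sub_cancel])
    u (mem_univ u)
  rw [mem_filter] at hx
  exact ⟨x, (Fib19.isOdd_iff_oddZeros x).1 hx.2, hxu.symm⟩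

/-- **THE HORIZON LAW (ring frame; no degree, field or complexity hypothesis).**  If every output `g` of the ring
strategy `z` has a HORIZON — an aligned triple `{2j, 2j+1, 2j+2}` (no wrap) of pattern letters it does not read and which
avoids its bond `{g, g+1}` — then `z` is not perfect on the odd class: some odd pattern violates the ring relation. -/
theorem horizon_loss {N : ℕ} (hN : 3 ≤ N) (z : (Fin N → Bool) → Fin N → Bool)
    (hz : ∀ g : Fin N, ∃ j : ℕ, 2 * j + 2 < N ∧ g.val + 1 ≠ 2 * j ∧ g.val ≠ 2 * j ∧ g.val ≠ 2 * j + 1 ∧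
      g.val ≠ 2 * j + 2 ∧ (j = 0 → g.val + 1 ≠ N) ∧
      ∀ x x' : Fin N → Bool, (∀ i : Fin N, i.val ≠ 2 * j → i.val ≠ 2 * j + 1 → i.val ≠ 2 * j + 2 → x i = x' i) →
        z x g = z x' g) :
    ∃ x : Fin N → Bool, OddZeros x ∧ ¬ Rel x (z x) := by
  obtain ⟨n, rfl⟩ : ∃ n, N = n + 1 := ⟨N - 1, by omega⟩
  have hn : 2 ≤ n := by omega
  let y : Fin (n + 1) → (Fin n → Bool) → Bool := fun g u => xor (z (xOfU u) g) (tGuess (xOfU u) g)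
  have hy : ∀ g : Fin (n + 1), ∃ j : Fin (n / 2), g.val ≠ 2 * j.val + 1 ∧
      ∀ u u' : Fin n → Bool, (∀ i : Fin n, i.val ≠ 2 * j.val → i.val ≠ 2 * j.val + 1 → u i = u' i) →
        y g u = y g u' := by
    intro g
    obtain ⟨j, hj, h1, h2, h3, h4, h5, hblind⟩ := hz g
    refine ⟨⟨j, by omega⟩, h3, fun u u' huu => ?_⟩
    dsimp only at huu
    have hx : ∀ i : Fin (n + 1), i.val ≠ 2 * j → i.val ≠ 2 * j + 1 → i.val ≠ 2 * j + 2 →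
        xOfU u i = xOfU u' i := by
      intro i hi1 hi2 hi3
      apply RingLocalPolylog.xOfU_congr
      intro m hm
      exact huu m (by omega) (by omega)
    have hg1 : xOfU u g = xOfU u' g := hx g h2 h3 h4
    have hg2 : xOfU u (nxt g) = xOfU u' (nxt g) := by
      have hv : (nxt g).val = (g.val + 1) % (n + 1) := rfl
      have hcase : (g.val + 1) % (n + 1) = g.val + 1 ∨ ((g.val + 1) % (n + 1) = 0 ∧ g.val = n) := by
        by_cases hlt : g.val + 1 < n + 1
        · exact Or.inl (Nat.mod_eq_of_lt hlt)
        · exact Or.inr ⟨by rw [show g.val + 1 = n + 1 by omega, Nat.mod_self], by omega⟩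
      apply hx <;> omega
    show xor (z (xOfU u) g) (tGuess (xOfU u) g) = xor (z (xOfU u') g) (tGuess (xOfU u') g)
    rw [hblind (xOfU u) (xOfU u') hx]
    unfold tGuess
    rw [hg1, hg2]
  obtain ⟨u, hu⟩ := ringWinU_box_fail (n + 2) (k := n / 2) (by omega) y hy
  obtain ⟨x, hxodd, hxu⟩ := exists_odd_uVec_eq hn u
  refine ⟨x, hxodd, fun hrel => ?_⟩
  have h' : ringWinU (n + 2) y u = true := by
    rw [← hxu]; exact (rel_iff_ringWinU hn x hxodd z).1 hrel
  rw [hu] at h'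
  exact Bool.false_ne_true h'

/-! ## §3 Windows: a cyclic radius-`r` window with `2r + 7 ≤ N` leaves a horizon -/

/-- Block selection: a radius-`r` window at `k` on `C_N`, `2r+7 ≤ N`, leaves an aligned triple off the window and the bond. -/
theorem select_block (N r k : ℕ) (hN : 2 * r + 7 ≤ N) (hk : k < N) :
    ∃ j : ℕ, 2 * j + 2 < N ∧ k + 1 ≠ 2 * j ∧ k ≠ 2 * j ∧ k ≠ 2 * j + 1 ∧ k ≠ 2 * j + 2 ∧ (j = 0 → k + 1 ≠ N) ∧
      ∀ p, 2 * j ≤ p → p ≤ 2 * j + 2 → ¬ ((p + N - k) % N ≤ r ∨ (k + N - p) % N ≤ r) := by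
  have hmod : ∀ p, p < N → ((p + N - k) % N = if k ≤ p then p - k else p + N - k) ∧
      ((k + N - p) % N = if p ≤ k then k - p else k + N - p) := by
    intro p hp
    constructor
    · split_ifs with h
      · rw [show p + N - k = (p - k) + N by omega, Nat.add_mod_right, Nat.mod_eq_of_lt (by omega)]
      · rw [Nat.mod_eq_of_lt (by omega)]
    · split_ifs with h
      · rw [show k + N - p = (k - p) + N by omega, Nat.add_mod_right, Nat.mod_eq_of_lt (by omega)]
      · rw [Nat.mod_eq_of_lt (by omega)]
  by_cases hsp : r = 0 ∧ k + 1 = N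
  · refine ⟨1, by omega, by omega, by omega, by omega, by omega, by omega, ?_⟩
    intro p hp1 hp2
    obtain ⟨e1, e2⟩ := hmod p (by omega)
    rw [e1, e2]; split_ifs <;> omega
  by_cases hR : ((k + r) % 2 = 0 ∧ k + r + 4 ≤ N - 1) ∨ ((k + r) % 2 = 1 ∧ k + r + 5 ≤ N - 1)
  · refine ⟨(k + r + 3) / 2, by omega, by omega, by omega, by omega, by omega, by omega, ?_⟩
    intro p hp1 hp2
    obtain ⟨e1, e2⟩ := hmod p (by omega)
    rw [e1, e2]; split_ifs <;> omega
  · refine ⟨(k + r + 1 - N + 1) / 2, by omega, by omega, by omega, by omega, by omega, by omega, ?_⟩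
    intro p hp1 hp2
    obtain ⟨e1, e2⟩ := hmod p (by omega)
    rw [e1, e2]; split_ifs <;> omega

/-- **WINDOW LAW (degree-free).**  On `C_N`, a ring strategy every output `k` of which reads only letters at cyclic distance
`≤ r` from `k` (the tree's locality hypothesis, empty junta), `2r + 7 ≤ N`, is not perfect on the odd class.  Tree floor:
radius `(log₂ N)^C` (`ringLocal_polylog_lt3`, `ringLocalJunta_polylog_lt3`); here the window may cover all but SIX letters. -/
theorem window_loss {N r : ℕ} (hN : 2 * r + 7 ≤ N) (z : (Fin N → Bool) → Fin N → Bool)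
    (hz : ∀ x x' : Fin N → Bool, ∀ k : Fin N,
      (∀ j : Fin N, ((j.val + N - k.val) % N ≤ r ∨ (k.val + N - j.val) % N ≤ r) → x j = x' j) → z x k = z x' k) :
    ∃ x : Fin N → Bool, OddZeros x ∧ ¬ Rel x (z x) := by
  apply horizon_loss (by omega) z
  intro g
  obtain ⟨j, hj, h1, h2, h3, h4, h5, hfar⟩ := select_block N r g.val hN g.isLt
  refine ⟨j, hj, h1, h2, h3, h4, h5, fun x x' hxx' => hz x x' g fun i hi => ?_⟩
  apply hxx'
  · intro he; exact hfar i.val (by omega) (by omega) hi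
  · intro he; exact hfar i.val (by omega) (by omega) hi
  · intro he; exact hfar i.val (by omega) (by omega) hi

/-! ## §3F Fan-in: read-sets of size `f` with `4f + 11 ≤ N` leave a horizon (ARBITRARY wiring) -/

/-- **FAN-IN LAW (degree-free, arbitrary wiring).**  If every output reads a set of `≤ f` letters (`AffBells22.ReadsOnly`),
`4f + 11 ≤ N`, the strategy is not perfect on the odd class (the `⌊(N-1)/2⌋ ≥ 2f+5` aligned triples cannot all be hit:
each letter meets `≤ 2`, the bond of `g` `≤ 3`, plus `j = 0`).  Tree floor: `(log₂ N)^C` (`AffBells34.coverPolylogHard`). -/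
theorem fanIn_loss {N f : ℕ} (hN : 4 * f + 11 ≤ N) (z : (Fin N → Bool) → Fin N → Bool)
    (hz : ∀ g : Fin N, ∃ S : Finset (Fin N), S.card ≤ f ∧ AffBells22.ReadsOnly S (fun x => z x g)) :
    ∃ x : Fin N → Bool, OddZeros x ∧ ¬ Rel x (z x) := by
  apply horizon_loss (by omega) z
  intro g
  obtain ⟨S, hS, hread⟩ := hz g
  let bad : Finset ℕ := S.biUnion (fun p => ({p.val / 2 - 1, p.val / 2} : Finset ℕ)) ∪
    ({g.val / 2 - 1, g.val / 2, (g.val + 1) / 2, 0} : Finset ℕ)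
  have hbad : bad.card ≤ 2 * f + 4 := by
    calc bad.card ≤ (S.biUnion (fun p => ({p.val / 2 - 1, p.val / 2} : Finset ℕ))).card +
          ({g.val / 2 - 1, g.val / 2, (g.val + 1) / 2, 0} : Finset ℕ).card := card_union_le _ _
      _ ≤ S.card * 2 + 4 := by
          apply Nat.add_le_add
          · refine (card_biUnion_le).trans ?_
            rw [mul_comm]
            refine (Finset.sum_le_card_nsmul S _ 2 (fun p _ => card_le_two)).trans ?_
            simp [mul_comm]
          · exact (card_insert_le _ _).trans (Nat.succ_le_succ ((card_insert_le _ _).trans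
              (Nat.succ_le_succ ((card_insert_le _ _).trans (Nat.succ_le_succ (card_singleton _).le)))))
      _ ≤ 2 * f + 4 := by omega
  have hlt : bad.card < (range ((N - 1) / 2)).card := by rw [card_range]; omega
  obtain ⟨j, hj, hjbad⟩ := exists_mem_notMem_of_card_lt_card hlt
  rw [mem_range] at hj
  have hnot : ∀ q : ℕ, q ∈ bad → q ≠ j := fun q hq hqj => hjbad (hqj ▸ hq)
  have hg1 : g.val / 2 - 1 ≠ j := hnot _ (by simp [bad])
  have hg2 : g.val / 2 ≠ j := hnot _ (by simp [bad])
  have hg3 : (g.val + 1) / 2 ≠ j := hnot _ (by simp [bad])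
  have hg4 : (0 : ℕ) ≠ j := hnot _ (by simp [bad])
  have hS1 : ∀ p ∈ S, p.val / 2 - 1 ≠ j := fun p hp => hnot _ (by
    simp only [bad, mem_union, mem_biUnion, mem_insert, mem_singleton]
    exact Or.inl ⟨p, hp, Or.inl rfl⟩)
  have hS2 : ∀ p ∈ S, p.val / 2 ≠ j := fun p hp => hnot _ (by
    simp only [bad, mem_union, mem_biUnion, mem_insert, mem_singleton]
    exact Or.inl ⟨p, hp, Or.inr rfl⟩)
  refine ⟨j, by omega, by omega, by omega, by omega, by omega, by omega, fun x x' hxx' => hread x x' fun i hi => ?_⟩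
  have h1 := hS1 i hi
  have h2 := hS2 i hi
  exact hxx' i (by omega) (by omega) (by omega)

end RingFrame

end RingHorizon

end Summit.QuantumAdvantage.AdviceFreeQNC0
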